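import Mathlib
import Summits.ValiantsHypothesis.ValiantsHypothesis.Theses.ElementaryWordLength
import Summits.ValiantsHypothesis.ValiantsHypothesis.Theses.DetQP
import Summits.ValiantsHypothesis.ValiantsHypothesis.Theorems.ElementaryWordLengthVpWordQp
import Summits.ValiantsHypothesis.ValiantsHypothesis.Theorems.ElementaryWordLengthWordToFormula
import Summits.ValiantsHypothesis.ValiantsHypothesis.Theorems.DetqpThesis.Negative.IffPerNotVQP
import Summits.ValiantsHypothesis.ValiantsHypothesis.Theorems.ElementaryWordLengthWordLengthQPRung0Nonuniversal
import Literature.Computability.AlgebraicComplexity.CircuitDepthProofs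
import Literature.Computability.AlgebraicComplexity.StandardFamiliesProofs
import Literature.Computability.AlgebraicComplexity.QuasiPolynomialFormulas

/-!
# Crux `WordLengthQP` (stmt-ValiantsHypothesis-6623) IS the Extended Valiant Hypothesis over `ℂ`

The route dossier (`Theses/ElementaryWordLength.lean`, "X ⟺ per ∉ VQF = VQP: the Extended Valiant
Hypothesis (BCS97 (21.32), (21.41)) in word form") and every seat of the line `Sketch` have READ the
crux as the Extended Valiant Hypothesis, but the tree carried no theorem saying so for THIS crux
(the sibling crux `DetqpThesis`, stmt-ValiantsHypothesis-0315, has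
`detqpThesis_iff_extendedValiantHypothesis`).  This file supplies the calibration, unconditionally
and from tree theorems only:

* `stub_vqpWordQp` (registered stub of the skeleton v18) — **`VQP ⊆ VQF` in word form**: every `VQP` family over `ℂ` (p-family with
  quasi-polynomially bounded circuit complexity) has affine elementary words of quasi-polynomial
  length for `E₁₃(fₙ)` — the route's landed `VpWordQp.hasWordAt_of_complexity_le`
  (VSBR/Hyafil stage recursion + Ben-Or–Cleve word algebra, p-family bookkeeping replaced by the
  qp bound on `L(fₙ)`);
* `stub_isVQPFamily_perPoly_of_hasWords` (registered stub) — conversely quasi-polynomial words for `E₁₃(per_n)` put the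
  permanent family in `VQP` (`wordToFormula_proof`: `E(f) ≤ 20(L+1)³`, and `L(f) ≤ E(f)`);
* `hasWords_perPoly_iff_isVQPFamily`, `wordLengthQP_iff_not_isVQPFamily_perPoly` — hence the crux
  is LITERALLY `PER ∉ VQP` over `ℂ`;
* `wordLengthQP_iff_extendedValiantHypothesis` — and, by Valiant's completeness theorem and the
  downward closure of `VQP` (sibling file `IffPerNotVQP.lean`,
  `not_isVQPFamily_perPoly_iff_extendedValiantHypothesis`), it is the tree's
  `ExtendedValiantHypothesis ℂ = ¬ (VNP ℂ ⊆ VQP ℂ)` (BCS97 (21.32); Bürgisser 2000 §8.1, open);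
* `wordLengthQP_iff_detqpThesis` — the two rank-0 cruxes of the summit's routes
  `ElementaryWordLength` and `DetQP` are ONE proposition;
* `ladderPos_iff_extendedValiantHypothesis` — the one open stub `stub_ladder_pos` of the line
  `Sketch` (rungs `q ≥ 1` of the ε-order ladder, certified crux-equivalent by
  `rung0_ladderPos_iff_wordLengthQP`) is therefore the Extended Valiant Hypothesis as well.

Consequence for the line protocol: any completion of the skeleton `Lines/Sketch.lean` is a proof
of `VNP ℂ ⊄ VQP ℂ`; a refutation of the crux is the collapse `VNP ℂ ⊆ VQP ℂ` — nothing weaker on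
either side.  Axioms: `propext`, `Classical.choice`, `Quot.sound`.

References: [BurgisserClausenShokrollahi1997] (21.32) p. 591, Thm. (21.33), (21.40)–(21.41)
p. 598, Problem 21.5 p. 605; [Burgisser2000] Def. 2.26, §8.1; [BenOrCleve1992] Thm. 1;
[ValiantSkyumBerkowitzRackoff1983].
-/

-- `Summit.ValiantsHypothesis.ValiantsHypothesis.…` is the tree's mandated single-conjunct layout
-- (Sub = Summit), so the duplicated namespace component is intended.
set_option linter.dupNamespace false

noncomputable section

namespace Summit.ValiantsHypothesis.ValiantsHypothesis.Cruxes.WordLengthQP.EpsOrderLadder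

open Literature.Computability.AlgebraicComplexity
open Summit.ValiantsHypothesis.ValiantsHypothesis.Theses (DetQP.DetqpThesis)
open Summit.ValiantsHypothesis.ValiantsHypothesis.Theses.ElementaryWordLength (WordLengthQP)
open Summit.ValiantsHypothesis.Theorems.DetqpThesis.Negative
  (one_le_qpExp not_isVQPFamily_perPoly_iff_extendedValiantHypothesis
    detqpThesis_iff_extendedValiantHypothesis)

/-! ### Exponent bookkeeping -/

/-- Quadratic bookkeeping: `23 ((ℓ+1)A + e)² ≤ 23(A+1)² (ℓ+1)² e²` for `e ≥ 1`. [folklore] -/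
theorem sq_bound_aux23 (ℓ A e : ℕ) (he : 1 ≤ e) :
    23 * ((ℓ + 1) * A + e) ^ 2 ≤ 23 * (A + 1) ^ 2 * (ℓ + 1) ^ 2 * e ^ 2 := by
  have hb : (ℓ + 1) * A ≤ (ℓ + 1) * A * e := Nat.le_mul_of_pos_right _ he
  have hc : e ≤ (ℓ + 1) * e := Nat.le_mul_of_pos_left _ (by omega)
  have h1 : (ℓ + 1) * A + e ≤ (ℓ + 1) * (A + 1) * e := by
    have : (ℓ + 1) * (A + 1) * e = (ℓ + 1) * A * e + (ℓ + 1) * e := by ring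
    omega
  have h2 : ((ℓ + 1) * A + e) ^ 2 ≤ ((ℓ + 1) * (A + 1) * e) ^ 2 := Nat.pow_le_pow_left h1 _
  have h3 : 23 * ((ℓ + 1) * (A + 1) * e) ^ 2 = 23 * (A + 1) ^ 2 * (ℓ + 1) ^ 2 * e ^ 2 := by ring
  calc 23 * ((ℓ + 1) * A + e) ^ 2 ≤ 23 * ((ℓ + 1) * (A + 1) * e) ^ 2 := Nat.mul_le_mul_left _ h2
    _ = 23 * (A + 1) ^ 2 * (ℓ + 1) ^ 2 * e ^ 2 := h3

/-- Exponent bookkeeping: `23 E² ≤ (ℓ + c')^{c'}` for `E = (ℓ+1)A + (ℓ+c)^c`,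
`c' = 2c + 23(A+1)² + 3`. [folklore] -/
theorem exp_bound_vqp_to_word (ℓ c A : ℕ) :
    23 * ((ℓ + 1) * A + (ℓ + c) ^ c) ^ 2 ≤
      (ℓ + (2 * c + 23 * (A + 1) ^ 2 + 3)) ^ (2 * c + 23 * (A + 1) ^ 2 + 3) := by
  have h2 := sq_bound_aux23 ℓ A ((ℓ + c) ^ c) (one_le_qpExp ℓ c)
  have h3 : 23 * (A + 1) ^ 2 ≤ ℓ + (2 * c + 23 * (A + 1) ^ 2 + 3) := by omega
  have h4 : (ℓ + 1) ^ 2 ≤ (ℓ + (2 * c + 23 * (A + 1) ^ 2 + 3)) ^ 2 :=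
    Nat.pow_le_pow_left (by omega) _
  have h5 : ((ℓ + c) ^ c) ^ 2 ≤
      (ℓ + (2 * c + 23 * (A + 1) ^ 2 + 3)) ^ (2 * c + 23 * (A + 1) ^ 2) := by
    rw [← pow_mul]
    calc (ℓ + c) ^ (c * 2) ≤ (ℓ + (2 * c + 23 * (A + 1) ^ 2 + 3)) ^ (c * 2) :=
          Nat.pow_le_pow_left (by omega) _
      _ ≤ (ℓ + (2 * c + 23 * (A + 1) ^ 2 + 3)) ^ (2 * c + 23 * (A + 1) ^ 2) :=
          Nat.pow_le_pow_right (by omega) (by omega)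
  have h6 : (ℓ + (2 * c + 23 * (A + 1) ^ 2 + 3)) * (ℓ + (2 * c + 23 * (A + 1) ^ 2 + 3)) ^ 2 *
      (ℓ + (2 * c + 23 * (A + 1) ^ 2 + 3)) ^ (2 * c + 23 * (A + 1) ^ 2) =
      (ℓ + (2 * c + 23 * (A + 1) ^ 2 + 3)) ^ (2 * c + 23 * (A + 1) ^ 2 + 3) := by
    rw [← pow_succ', ← pow_add]
    congr 1
    omega
  calc 23 * ((ℓ + 1) * A + (ℓ + c) ^ c) ^ 2
      ≤ 23 * (A + 1) ^ 2 * (ℓ + 1) ^ 2 * ((ℓ + c) ^ c) ^ 2 := h2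
    _ ≤ (ℓ + (2 * c + 23 * (A + 1) ^ 2 + 3)) * (ℓ + (2 * c + 23 * (A + 1) ^ 2 + 3)) ^ 2 *
          (ℓ + (2 * c + 23 * (A + 1) ^ 2 + 3)) ^ (2 * c + 23 * (A + 1) ^ 2) :=
        Nat.mul_le_mul (Nat.mul_le_mul h3 h4) h5
    _ = _ := h6

/-- Exponent bookkeeping for the converse: `3e + 8 ≤ (ℓ + (c + 11))^{c + 11}` for
`e = (ℓ + c)^c`. [folklore] -/
theorem exp_bound_word_to_vqp (ℓ c : ℕ) :
    3 * (ℓ + c) ^ c + 8 ≤ (ℓ + (c + 11)) ^ (c + 11) := by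
  have he := one_le_qpExp ℓ c
  have h1 : 3 * (ℓ + c) ^ c + 8 ≤ 11 * (ℓ + c) ^ c := by omega
  have h2 : 11 ≤ ℓ + (c + 11) := by omega
  have h3 : (ℓ + c) ^ c ≤ (ℓ + (c + 11)) ^ (c + 10) :=
    calc (ℓ + c) ^ c ≤ (ℓ + (c + 11)) ^ c := Nat.pow_le_pow_left (by omega) _
      _ ≤ (ℓ + (c + 11)) ^ (c + 10) := Nat.pow_le_pow_right (by omega) (by omega)
  calc 3 * (ℓ + c) ^ c + 8 ≤ 11 * (ℓ + c) ^ c := h1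
    _ ≤ (ℓ + (c + 11)) * (ℓ + (c + 11)) ^ (c + 10) := Nat.mul_le_mul h2 h3
    _ = (ℓ + (c + 11)) ^ (c + 11) := by rw [← pow_succ']

/-! ### `VQP ⊆ VQF` in word form -/

/-- **`VQP` families have quasi-polynomial affine elementary words.**  For every `VQP` family `f`
over `ℂ` (a p-family with quasi-polynomially bounded circuit complexity) there is `c` such that for
every `n` the transvection `E₁₃(fₙ)` is the matrix of a word of at most `2^{(log₂ n + c)^c}`
letters `E_{ij}(λ)`, `E_{ij}(λ·x_s)` (`i ≠ j`).  Proof: the route's landed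
`VpWordQp.hasWordAt_of_complexity_le` (BCS97 Thm. (21.36) stage recursion + Ben-Or–Cleve), with
`deg fₙ, #σₙ + 1 < 2^{(log₂ n + 1)A}` and `L(fₙ) ≤ 2^{(log₂ n + c)^c}`, so that
`E = (log₂ n + 1)A + (log₂ n + c)^c` gives length `≤ 2^{23E²} ≤ 2^{(log₂ n + c')^{c'}}`,
`c' = 2c + 23(A+1)² + 3`.
[cite: BurgisserClausenShokrollahi1997, Thm. (21.36) and (21.40); BenOrCleve1992, Thm. 1] -/
theorem stub_vqpWordQp {σ : ℕ → Type} [∀ n, Fintype (σ n)] (f : ∀ n, MvPolynomial (σ n) ℂ)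
    (hf : IsVQPFamily f) :
    ∃ c : ℕ, ∀ n : ℕ, ∃ w : List (Fin 3 × Fin 3 × ℂ × Option (σ n)),
      w.length ≤ 2 ^ ((Nat.log 2 n + c) ^ c) ∧ (∀ l ∈ w, l.1 ≠ l.2.1) ∧
      (w.map (fun l => Matrix.transvection l.1 l.2.1
        (MvPolynomial.C l.2.2.1 * l.2.2.2.elim 1 MvPolynomial.X))).prod =
        Matrix.transvection (0 : Fin 3) 2 (f n) := by
  obtain ⟨⟨hvarp, hdegp⟩, ⟨c, hc⟩⟩ := hf
  obtain ⟨A₁, hA₁, hdeg⟩ := IsPBounded.exists_lt_two_pow hdegp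
  obtain ⟨A₃, -, hV⟩ := IsPBounded.exists_lt_two_pow hvarp
  set A := A₁ + A₃ with hA
  refine ⟨2 * c + 23 * (A + 1) ^ 2 + 3, fun n => ?_⟩
  set ℓ := Nat.log 2 n with hℓ
  set E := (ℓ + 1) * A + (ℓ + c) ^ c with hE
  have hA1' : 1 ≤ (ℓ + 1) * A :=
    Nat.one_le_iff_ne_zero.2 (Nat.mul_ne_zero (by omega) (by omega))
  have hE1 : 1 ≤ E := le_add_right hA1'
  have hEd : (ℓ + 1) * A₁ ≤ E := (Nat.mul_le_mul_left _ (by omega)).trans (Nat.le_add_right _ _)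
  have hEV : (ℓ + 1) * A₃ ≤ E := (Nat.mul_le_mul_left _ (by omega)).trans (Nat.le_add_right _ _)
  have hd : (f n).totalDegree < 2 ^ E :=
    (hdeg n).trans_le (Nat.pow_le_pow_right (by norm_num) hEd)
  have hL : complexity (f n) ≤ 2 ^ E :=
    (hc n).trans (Nat.pow_le_pow_right (by norm_num) (Nat.le_add_left _ _))
  have hv : Fintype.card (σ n) + 1 ≤ 2 ^ E :=
    (hV n).trans_le (Nat.pow_le_pow_right (by norm_num) hEV)
  obtain ⟨w, hw, ho, hp⟩ :=
    Summit.ValiantsHypothesis.ValiantsHypothesis.Theorems.VpWordQp.hasWordAt_of_complexity_le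
      le_rfl hd hL hv hE1 (0 : Fin 3) 2 (by decide)
  exact ⟨w, hw.trans (Nat.pow_le_pow_right (by norm_num) (exp_bound_vqp_to_word ℓ c A)), ho, hp⟩

/-! ### Quasi-polynomial words put the permanent in `VQP` -/

/-- **Quasi-polynomial words for `E₁₃(per_n)` put the permanent family in `VQP`**: a word of
length `L ≤ 2^e` gives a formula of size `≤ 20(L+1)³ ≤ 2^{3e+8}` (`wordToFormula_proof`,
Ben-Or–Cleve / BIZ18 divide and conquer), a formula is a circuit (`L(f) ≤ E(f)`), and the
permanent is a p-family. [cite: BenOrCleve1992, Thm. 1; Burgisser2000, Def. 2.26] -/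
theorem stub_isVQPFamily_perPoly_of_hasWords
    (h : ∃ c : ℕ, ∀ n : ℕ, ∃ w : List (Fin 3 × Fin 3 × ℂ × Option (Fin n × Fin n)),
      w.length ≤ 2 ^ ((Nat.log 2 n + c) ^ c) ∧ (∀ l ∈ w, l.1 ≠ l.2.1) ∧
      (w.map (fun l => Matrix.transvection l.1 l.2.1
        (MvPolynomial.C l.2.2.1 * l.2.2.2.elim 1 MvPolynomial.X))).prod =
        Matrix.transvection (0 : Fin 3) 2 (perPoly (Fin n) ℂ)) :
    IsVQPFamily (fun n => perPoly (Fin n) ℂ) := by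
  obtain ⟨c, hc⟩ := h
  refine ⟨isPFamily_perPoly_holds, c + 11, fun n => ?_⟩
  set ℓ := Nat.log 2 n with hℓ
  set e := (ℓ + c) ^ c with he
  have hw := hc n
  -- word ⟹ formula of size `≤ 20 (2^e + 1)^3`
  have hform : formulaComplexity (perPoly (Fin n) ℂ) ≤ 20 * (2 ^ e + 1) ^ 3 :=
    Summit.ValiantsHypothesis.ValiantsHypothesis.Theorems.ElementaryWordLength.wordToFormula_proof
      (perPoly (Fin n) ℂ) (2 ^ e) hw
  -- formula ⟹ circuit
  have hcirc : complexity (perPoly (Fin n) ℂ) ≤ formulaComplexity (perPoly (Fin n) ℂ) :=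
    complexity_le_formulaComplexity_holds _
  -- arithmetic: `20 (2^e + 1)^3 ≤ 2^(3e + 8) ≤ 2^((ℓ + (c+11))^(c+11))`
  have h1 : 2 ^ e + 1 ≤ 2 ^ (e + 1) := by rw [pow_succ]; have := Nat.one_le_two_pow (n := e); omega
  have h2 : (2 ^ e + 1) ^ 3 ≤ 2 ^ (3 * e + 3) := by
    calc (2 ^ e + 1) ^ 3 ≤ (2 ^ (e + 1)) ^ 3 := Nat.pow_le_pow_left h1 3
      _ = 2 ^ (3 * e + 3) := by rw [← pow_mul]; ring_nf
  have h3 : 20 * (2 ^ e + 1) ^ 3 ≤ 2 ^ (3 * e + 8) := by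
    calc 20 * (2 ^ e + 1) ^ 3 ≤ 2 ^ 5 * 2 ^ (3 * e + 3) := Nat.mul_le_mul (by norm_num) h2
      _ = 2 ^ (3 * e + 8) := by rw [← pow_add]; ring_nf
  calc complexity (perPoly (Fin n) ℂ) ≤ 20 * (2 ^ e + 1) ^ 3 := hcirc.trans hform
    _ ≤ 2 ^ (3 * e + 8) := h3
    _ ≤ 2 ^ ((ℓ + (c + 11)) ^ (c + 11)) :=
        Nat.pow_le_pow_right (by norm_num) (exp_bound_word_to_vqp ℓ c)

/-- **Quasi-polynomial words for `E₁₃(per_n)` exist iff `PER ∈ VQP` over `ℂ`.**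
[cite: BurgisserClausenShokrollahi1997, Thm. (21.33) and (21.40)] -/
theorem hasWords_perPoly_iff_isVQPFamily :
    (∃ c : ℕ, ∀ n : ℕ, ∃ w : List (Fin 3 × Fin 3 × ℂ × Option (Fin n × Fin n)),
      w.length ≤ 2 ^ ((Nat.log 2 n + c) ^ c) ∧ (∀ l ∈ w, l.1 ≠ l.2.1) ∧
      (w.map (fun l => Matrix.transvection l.1 l.2.1
        (MvPolynomial.C l.2.2.1 * l.2.2.2.elim 1 MvPolynomial.X))).prod =
        Matrix.transvection (0 : Fin 3) 2 (perPoly (Fin n) ℂ)) ↔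
    IsVQPFamily (fun n => perPoly (Fin n) ℂ) :=
  ⟨stub_isVQPFamily_perPoly_of_hasWords, fun h => stub_vqpWordQp (fun n => perPoly (Fin n) ℂ) h⟩

/-! ### The crux is `PER ∉ VQP`, i.e. the Extended Valiant Hypothesis, i.e. `DetqpThesis` -/

/-- **The crux `WordLengthQP` is LITERALLY `PER ∉ VQP` over `ℂ`.**
[cite: BurgisserClausenShokrollahi1997, (21.41) p. 598] -/
theorem wordLengthQP_iff_not_isVQPFamily_perPoly :
    WordLengthQP ↔ ¬ IsVQPFamily (fun n => perPoly (Fin n) ℂ) := by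
  unfold Summit.ValiantsHypothesis.ValiantsHypothesis.Theses.ElementaryWordLength.WordLengthQP
  exact not_congr hasWords_perPoly_iff_isVQPFamily

/-- **The crux `WordLengthQP` is the Extended Valiant Hypothesis over `ℂ`**
(`ExtendedValiantHypothesis ℂ = ¬ (VNP ℂ ⊆ VQP ℂ)`, BCS97 (21.32)): a proof of the crux is a proof
of `VNP ⊄ VQP`, a refutation of the crux is the collapse `VNP ℂ ⊆ VQP ℂ` — nothing weaker on either
side.  Printed source: BCS97 p. 591 "(21.32) Extended Valiant Hypothesis. VNP ∖ VQP ≠ ∅ over any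
field"; Problem 21.5 p. 605 (open). [cite: BurgisserClausenShokrollahi1997, (21.32) p. 591 and Problem 21.5 p. 605] -/
theorem wordLengthQP_iff_extendedValiantHypothesis :
    WordLengthQP ↔ ExtendedValiantHypothesis ℂ :=
  wordLengthQP_iff_not_isVQPFamily_perPoly.trans
    (not_isVQPFamily_perPoly_iff_extendedValiantHypothesis ℂ (by rw [ringChar.eq_zero]; decide))

/-- **The rank-0 cruxes of routes `ElementaryWordLength` and `DetQP` coincide**: `WordLengthQP`
(stmt-ValiantsHypothesis-6623, word length of `E₁₃(per_n)` not quasi-polynomial) `↔`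
`DetqpThesis` (stmt-ValiantsHypothesis-0315, `dc(per_n)` not quasi-polynomial) — both are the
Extended Valiant Hypothesis over `ℂ`. [cite: BurgisserClausenShokrollahi1997, (21.40)–(21.41) p. 598] -/
theorem wordLengthQP_iff_detqpThesis : WordLengthQP ↔ DetQP.DetqpThesis :=
  wordLengthQP_iff_extendedValiantHypothesis.trans detqpThesis_iff_extendedValiantHypothesis.symm

/-- **The open stub of line `Sketch` is the Extended Valiant Hypothesis.**  The rungs `q ≥ 1` of
the ε-order ladder (`stub_ladder_pos` of `Cruxes/WordLengthQP/Lines/Sketch.lean`, certified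
crux-equivalent by the tree theorem `rung0_ladderPos_iff_wordLengthQP`) hold iff
`VNP ℂ ⊄ VQP ℂ`. [cite: BurgisserClausenShokrollahi1997, (21.32) p. 591] -/
theorem ladderPos_iff_extendedValiantHypothesis :
    (∀ c : ℕ, ∃ n : ℕ, 10 ≤ n ∧ ∀ q L : ℕ, 1 ≤ q → q ≤ 2 ^ ((Nat.log 2 n + c) ^ c) →
      L ≤ 2 ^ ((Nat.log 2 n + c) ^ c) →
      ¬ (∃ ms : List (Matrix (Fin 2) (Fin 2) (MvPolynomial (Fin n × Fin n) (Polynomial ℂ))),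
          ms.length ≤ L ∧
          (∀ m ∈ ms, ∀ i j : Fin 2, (∃ b : Polynomial ℂ, m i j = MvPolynomial.C b) ∨
            (∃ (a b : Polynomial ℂ) (v : Fin n × Fin n),
              m i j = MvPolynomial.C a * MvPolynomial.X v + MvPolynomial.C b)) ∧
          ∃ G : MvPolynomial (Fin n × Fin n) (Polynomial ℂ),
            ms.prod 0 0 = MvPolynomial.C (Polynomial.X ^ q) *
                MvPolynomial.map Polynomial.C (perPoly (Fin n) ℂ) +
              MvPolynomial.C (Polynomial.X ^ (q + 1)) * G)) ↔
    ExtendedValiantHypothesis ℂ :=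
  rung0_ladderPos_iff_wordLengthQP.trans wordLengthQP_iff_extendedValiantHypothesis

end Summit.ValiantsHypothesis.ValiantsHypothesis.Cruxes.WordLengthQP.EpsOrderLadder

end
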